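import Mathlib
import Summits.NavierStokesRegularity.NavierStokesRegularity.Theorems.EfficiencyFloorMaximiserSetRigidityRotatingLiouville
import Literature.Analysis.FluidPDE.KNSSRegularityGalilean
import HarnessLib

/-!
# Route `EfficiencyFloor`, crux `MaximiserSetRigidity` (stmt-NavierStokesRegularity-25512) ⇒ `RigidExit`
# (stmt-NavierStokesRegularity-25513), dynamic form of part (b): NO classical Navier–Stokes solution moves along
# a smooth curve in the symmetry orbit of a normalised maximiser

Helper file (`--supports stmt-NavierStokesRegularity-25513`). `RigidExit` (MaximiserSetRigidity →
NearMaximiserBoundedAmplification) argues: "no Navier–Stokes trajectory stays in the normalised maximiser set on a time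
interval (it would lie in one G-orbit, be C¹ in G modulo the stabiliser, and make the maximiser a relative
equilibrium)". This file proves the last implication in the kernel, now that part (b) is a theorem
(`ProfileLiouville.partB_holds`, p823327): if a classical solution `(u,p)` on an open time set `S ∋ s` has the
ORBIT FORM `u(t,x) = λ(t) R(t) m(λ(t) R(t)⁻¹ (x − a(t)))` on `S`, with `m` a normalised maximiser, `λ(s) > 0`, the
parameter paths differentiable at `s`, `R(t)` linear isometries (`⟪R(t)v, R(t)w⟫ = ⟪v,w⟫`, `R(t)⁻¹R(t) = 1`), then
differentiating at `s` and undoing the symmetry exhibits `m` as a relative equilibrium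
`νΔm − (m·∇)m − ∇π = (d·∇)m + ((W̃x)·∇)m − W̃m + c′(m + (x·∇)m)` with `c′ = λ'/λ³`, `W̃ = −λ⁻²R⁻¹Rd` (skew, from the
isometry constraint), `d = −λ⁻¹R⁻¹adot`, `π(y) = λ⁻²p(s, a + λ⁻¹Ry)` — contradicting part (b).

* `RotatingOrbit.hasDerivAt_movingOrbit` — chain rule for `σ ↦ λ(σ) R(σ) m(λ(σ) R(σ)⁻¹(x − a(σ)))` (abstract paths);
* `ProfileLiouville.no_movingOrbit_solution` — the statement above (`False` from the orbit form).

What remains of `RigidExit` after this: (i) the selection of differentiable parameter paths for a trajectory inside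
the maximiser set (slice theorem for the G-action, using part (a)'s finiteness), (ii) continuous dependence in
`Ḣ¹ ∩ Ḣ²` on closed windows. HONEST FRAMING: `RigidExit`, part (a), `NearMaximiserBoundedAmplification`,
`LerayFloorGap`, `ProductionEfficiencyDecay` and Navier–Stokes regularity stay OPEN; no summit statement is proved.
[folklore]
-/

noncomputable section

-- the problem directory repeats the summit name (`NavierStokesRegularity/NavierStokesRegularity`)
set_option linter.dupNamespace false

namespace Summit.NavierStokesRegularity.NavierStokesRegularity.Theorems

namespace MaximiserSetRigidity

namespace RotatingOrbit

open Set Function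

variable {E : Type*} [NormedAddCommGroup E] [NormedSpace ℝ E]

/-- **Chain rule along a moving symmetry orbit.** For paths `λ, a, R, R'` differentiable at `s` (derivatives
`l', adot, Rd, Rd'`) and `m` differentiable at `y = λ(s)R'(s)(x − a(s))`:
`∂_σ[λ R m(λ R'(x − a))](s) = λ(Rd m(y) + R Dm(y)[λ(Rd'(x−a) − R'adot) + l' R'(x−a)]) + l' R m(y)`. [folklore] -/
theorem hasDerivAt_movingOrbit {lam : ℝ → ℝ} {a : ℝ → E} {Rc Rc' : ℝ → (E →L[ℝ] E)} {m : E → E}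
    {s l' : ℝ} {adot : E} {Rd Rd' : E →L[ℝ] E} (x y : E)
    (hlam : HasDerivAt lam l' s) (ha : HasDerivAt a adot s) (hRc : HasDerivAt Rc Rd s) (hRc' : HasDerivAt Rc' Rd' s)
    (hy : lam s • Rc' s (x - a s) = y) (hm : DifferentiableAt ℝ m y) :
    HasDerivAt (fun σ => lam σ • Rc σ (m (lam σ • Rc' σ (x - a σ))))
      (lam s • (Rd (m y) + Rc s (fderiv ℝ m y (lam s • (Rd' (x - a s) - Rc' s adot) + l' • Rc' s (x - a s)))) +
        l' • Rc s (m y)) s := by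
  have hw : HasDerivAt (fun σ => Rc' σ (x - a σ)) (Rd' (x - a s) + Rc' s (0 - adot)) s :=
    hRc'.clm_apply ((hasDerivAt_const s x).sub ha)
  have hz : HasDerivAt (fun σ => lam σ • Rc' σ (x - a σ))
      (lam s • (Rd' (x - a s) + Rc' s (0 - adot)) + l' • Rc' s (x - a s)) s := hlam.smul hw
  have hzs : (fun σ => lam σ • Rc' σ (x - a σ)) s = y := by simp only [hy]
  have hm' : HasFDerivAt m (fderiv ℝ m y) ((fun σ => lam σ • Rc' σ (x - a σ)) s) := by
    rw [hzs]; exact hm.hasFDerivAt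
  have hn := hm'.comp_hasDerivAt s hz
  have hq : HasDerivAt (fun σ => Rc σ (m (lam σ • Rc' σ (x - a σ))))
      (Rd (m (lam s • Rc' s (x - a s))) +
        Rc s (fderiv ℝ m y (lam s • (Rd' (x - a s) + Rc' s (0 - adot)) + l' • Rc' s (x - a s)))) s :=
    hRc.clm_apply hn
  have hu := hlam.smul hq
  refine hu.congr_deriv ?_
  simp only [hy]
  simp only [zero_sub]
  simp only [map_neg, sub_eq_add_neg]

end RotatingOrbit

namespace ProfileLiouville

open MeasureTheory Set Filter Topology Function InnerProductSpace
open scoped RealInnerProductSpace ContDiff Laplacian ENNReal NNReal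
open Literature.Analysis Literature.Analysis.FluidPDE RotatingOrbit

/-- **No classical Navier–Stokes solution moves along a smooth curve in the symmetry orbit of a normalised maximiser.**
(`c, ν > 0`; `m` satisfies the item's normalised-maximiser clause; `(u,p)` classical on an open time set `S ∋ s`;
`u(t,x) = λ(t)R(t)m(λ(t)R(t)⁻¹(x − a(t)))` on `S` with `λ(s) > 0`, `λ, a, R, R⁻¹` differentiable at `s`, `R(t)` linear
isometries with `R(t)⁻¹R(t) = 1` on `S`, and `R(s)` packaged as a linear isometric equivalence.) Differentiating at `s`
makes `m` a relative equilibrium, contradicting `partB_holds`. [folklore] -/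
theorem no_movingOrbit_solution (c ν : ℝ) (hc : 0 < c) (hν : 0 < ν)
    (m : EuclideanSpace ℝ (Fin 3) → EuclideanSpace ℝ (Fin 3))
    (hm : ((ContDiff ℝ (⊤ : ℕ∞) m ∧ Literature.Analysis.FluidPDE.VectorCalculus.IsDivFree m ∧ (∫⁻ x, ‖iteratedFDeriv ℝ 0
      m x‖ₑ ^ 2 < ⊤) ∧ (∫⁻ x, ‖iteratedFDeriv ℝ 1 m x‖ₑ ^ 2 < ⊤) ∧ (∫⁻ x, ‖iteratedFDeriv ℝ 2 m x‖ₑ ^ 2 < ⊤))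
      ∧ 0 < (∫ x, ‖Literature.Analysis.FluidPDE.curl m x‖ ^ 2) ∧ (∫ x, ⟪Literature.Analysis.FluidPDE.curl m x,
      fderiv ℝ m x (Literature.Analysis.FluidPDE.curl m x)⟫_ℝ) = c * (∫ x, ‖Literature.Analysis.FluidPDE.curl
      m x‖ ^ 2) ^ (3 / 4 : ℝ) * (∫ x, Literature.Analysis.FluidPDE.frobeniusNormSq (fderiv ℝ
      (Literature.Analysis.FluidPDE.curl m) x)) ^ (3 / 4 : ℝ) ∧ (∫ x,
      Literature.Analysis.FluidPDE.frobeniusNormSq (fderiv ℝ (Literature.Analysis.FluidPDE.curl m) x)) = 81 *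
      c ^ 4 / (256 * ν ^ 4) * (∫ x, ‖Literature.Analysis.FluidPDE.curl m x‖ ^ 2) ^ 3))
    {S : Set ℝ} (hS : IsOpen S) {s : ℝ} (hs : s ∈ S)
    {u : ℝ → EuclideanSpace ℝ (Fin 3) → EuclideanSpace ℝ (Fin 3)} {p : ℝ → EuclideanSpace ℝ (Fin 3) → ℝ}
    (hcl : IsClassicalNSSolutionOn S ν 0 u p)
    (lam : ℝ → ℝ) (a : ℝ → EuclideanSpace ℝ (Fin 3))
    (Rc Rc' : ℝ → (EuclideanSpace ℝ (Fin 3) →L[ℝ] EuclideanSpace ℝ (Fin 3)))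
    {l' : ℝ} {adot : EuclideanSpace ℝ (Fin 3)} {Rd Rd' : EuclideanSpace ℝ (Fin 3) →L[ℝ] EuclideanSpace ℝ (Fin 3)}
    (hlam : HasDerivAt lam l' s) (hl0 : 0 < lam s) (ha : HasDerivAt a adot s) (hRc : HasDerivAt Rc Rd s)
    (hRc' : HasDerivAt Rc' Rd' s)
    (hinv : ∀ t ∈ S, ∀ v, Rc' t (Rc t v) = v)
    (hiso : ∀ t ∈ S, ∀ v w : EuclideanSpace ℝ (Fin 3), ⟪Rc t v, Rc t w⟫_ℝ = ⟪v, w⟫_ℝ)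
    (R : EuclideanSpace ℝ (Fin 3) ≃ₗᵢ[ℝ] EuclideanSpace ℝ (Fin 3)) (hR : ∀ v, R v = Rc s v)
    (hR' : ∀ v, R.symm v = Rc' s v)
    (hu : ∀ t ∈ S, ∀ x, u t x = lam t • Rc t (m (lam t • Rc' t (x - a t)))) : False := by
  have hmS : ContDiff ℝ (⊤ : ℕ∞) m := hm.1.1
  have hm1 : Differentiable ℝ m := hmS.differentiable (by simp)
  have hm2 : ContDiff ℝ 2 m := contDiff_infty.1 hmS 2
  have hSs : S ∈ 𝓝 s := hS.mem_nhds hs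
  have hRR' : ∀ v, Rc s (Rc' s v) = v := fun v => by rw [← hR, ← hR', R.apply_symm_apply]
  -- derivative relations: `Rd' R + R' Rd = 0` and skewness of `R'Rd`
  have hRd'R : ∀ v, Rd' (Rc s v) + Rc' s (Rd v) = 0 := by
    intro v
    have h1 : HasDerivAt (fun σ => Rc σ v) (Rd v + Rc s 0) s := hRc.clm_apply (hasDerivAt_const s v)
    have h2 : HasDerivAt (fun σ => Rc' σ (Rc σ v)) (Rd' (Rc s v) + Rc' s (Rd v + Rc s 0)) s := hRc'.clm_apply h1
    have h3 : HasDerivAt (fun σ => Rc' σ (Rc σ v)) 0 s := by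
      refine (hasDerivAt_const s v).congr_of_eventuallyEq ?_
      filter_upwards [hSs] with t ht
      exact hinv t ht v
    have := h2.unique h3
    simpa using this
  have hskew0 : ∀ v w : EuclideanSpace ℝ (Fin 3), ⟪Rd v, Rc s w⟫_ℝ + ⟪Rc s v, Rd w⟫_ℝ = 0 := by
    intro v w
    have h1 : HasDerivAt (fun σ => Rc σ v) (Rd v + Rc s 0) s := hRc.clm_apply (hasDerivAt_const s v)
    have h2 : HasDerivAt (fun σ => Rc σ w) (Rd w + Rc s 0) s := hRc.clm_apply (hasDerivAt_const s w)
    have h3 : HasDerivAt (fun σ => ⟪Rc σ v, Rc σ w⟫_ℝ) (⟪Rc s v, Rd w + Rc s 0⟫_ℝ + ⟪Rd v + Rc s 0, Rc s w⟫_ℝ) s :=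
      h1.inner ℝ h2
    have h4 : HasDerivAt (fun σ => ⟪Rc σ v, Rc σ w⟫_ℝ) 0 s := by
      refine (hasDerivAt_const s ⟪v, w⟫_ℝ).congr_of_eventuallyEq ?_
      filter_upwards [hSs] with t ht
      exact hiso t ht v w
    have := h3.unique h4
    simp only [map_zero, add_zero] at this
    linarith
  -- the generator `W̃ = −λ⁻² R⁻¹ Rd` (skew)
  set W : EuclideanSpace ℝ (Fin 3) →L[ℝ] EuclideanSpace ℝ (Fin 3) :=
    -(((lam s)⁻¹ ^ 2) • (Rc' s).comp Rd) with hW_def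
  have hWv : ∀ v, W v = -(((lam s)⁻¹ ^ 2) • Rc' s (Rd v)) := fun v => by
    simp only [hW_def, FunLike.coe_neg, FunLike.coe_smul, Pi.neg_apply, Pi.smul_apply,
      ContinuousLinearMap.comp_apply]
  have hR'adj : ∀ z w : EuclideanSpace ℝ (Fin 3), ⟪Rc' s z, w⟫_ℝ = ⟪z, Rc s w⟫_ℝ := by
    intro z w
    rw [← hR', ← hR, ← R.inner_map_map (R.symm z) w, R.apply_symm_apply]
  have hWskew : ∀ v w : EuclideanSpace ℝ (Fin 3), ⟪W v, w⟫_ℝ = -⟪v, W w⟫_ℝ := by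
    intro v w
    have e1 : ⟪W v, w⟫_ℝ = -((lam s)⁻¹ ^ 2 * ⟪Rd v, Rc s w⟫_ℝ) := by
      rw [hWv, inner_neg_left, real_inner_smul_left, hR'adj]
    have e2 : ⟪v, W w⟫_ℝ = -((lam s)⁻¹ ^ 2 * ⟪Rc s v, Rd w⟫_ℝ) := by
      rw [hWv, inner_neg_right, real_inner_smul_right, real_inner_comm (Rc' s (Rd w)) v, hR'adj (Rd w) v,
        real_inner_comm (Rc s v) (Rd w)]
    rw [e1, e2]
    have := hskew0 v w
    linear_combination (-((lam s)⁻¹ ^ 2)) * this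
  -- the profile data at time `s`
  set c' : ℝ := l' / lam s ^ 3 with hc'_def
  set d : EuclideanSpace ℝ (Fin 3) := -((lam s)⁻¹ • Rc' s adot) with hd_def
  set π : EuclideanSpace ℝ (Fin 3) → ℝ := fun y => (lam s)⁻¹ ^ 2 * p s (a s + (lam s)⁻¹ • R y) with hπ_def
  have hπ : ContDiff ℝ (⊤ : ℕ∞) π := by
    have hp : ContDiff ℝ ∞ (p s) := hcl.contDiff_pressure hs
    have hinner : ContDiff ℝ ∞ (fun y : EuclideanSpace ℝ (Fin 3) => a s + (lam s)⁻¹ • R y) :=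
      contDiff_const.add (R.toContinuousLinearEquiv.contDiff.const_smul ((lam s)⁻¹))
    exact contDiff_const.mul (hp.comp hinner)
  -- the slices at time `s`
  have hus : u s = fun x => (fun z => lam s • R (m (lam s • R.symm z))) (x - a s) := by
    funext x; simp only [hu s hs, hR, hR']
  have hps : p s = fun x => (fun z => lam s ^ 2 * π (lam s • R.symm z)) (x - a s) := by
    funext x
    simp only [hπ_def]
    rw [map_smul, R.apply_symm_apply, smul_smul, inv_mul_cancel₀ hl0.ne', one_smul, add_sub_cancel, ← mul_assoc,
      show lam s ^ 2 * (lam s)⁻¹ ^ 2 = 1 by field_simp, one_mul]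
  -- the momentum equation at `(s, x)` with `x = a + λ⁻¹ R y`, for an arbitrary `y`
  refine partB_holds c ν hc hν m hm π d W c' hπ hWskew (fun y => ?_)
  set x : EuclideanSpace ℝ (Fin 3) := a s + (lam s)⁻¹ • R y with hx_def
  have hxy : lam s • R.symm (x - a s) = y := by
    rw [hx_def, add_sub_cancel_left, map_smul, R.symm_apply_apply, smul_smul, mul_inv_cancel₀ hl0.ne', one_smul]
  have hxy' : lam s • Rc' s (x - a s) = y := by rw [← hR']; exact hxy
  have hxa : x - a s = (lam s)⁻¹ • R y := by rw [hx_def, add_sub_cancel_left]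
  have hmom := hcl.momentum s hs x
  -- time derivative
  have hD := hasDerivAt_movingOrbit x y hlam ha hRc hRc' hxy' (hm1 y)
  have hTD : timeDerivWithin S u s x = lam s • (Rd (m y) + Rc s (fderiv ℝ m y (lam s • (Rd' (x - a s) - Rc' s adot) +
      l' • Rc' s (x - a s)))) + l' • Rc s (m y) := by
    rw [timeDerivWithin_eq_deriv hS hs]
    refine (hD.congr_of_eventuallyEq ?_).deriv
    filter_upwards [hSs] with t ht
    exact hu t ht x
  -- spatial terms
  have hC : convect (u s) (u s) x = lam s ^ 3 • R (convect m m y) := by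
    rw [hus]
    unfold convect
    rw [fderiv_comp_sub_right (fun z => lam s • R (m (lam s • R.symm z))) (a s) x]
    have := convect_slice R m (lam s) (x - a s)
    unfold convect at this
    rw [this, hxy]
  have hL : (Δ (u s)) x = lam s ^ 3 • R ((Δ m) y) := by
    rw [hus, laplacian_comp_sub_right (fun z => lam s • R (m (lam s • R.symm z))) (a s) x, laplacian_slice R hm2, hxy]
  have hG1 : gradient (p s) x = gradient (fun z => lam s ^ 2 * π (lam s • R.symm z)) (x - a s) := by
    rw [hps]
    unfold gradient
    rw [fderiv_comp_sub_right (fun z => lam s ^ 2 * π (lam s • R.symm z)) (a s) x]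
  have hG : gradient (p s) x = lam s ^ 3 • R (gradient π y) := by
    rw [hG1, gradient_pressure_slice, hxy]
  rw [hTD, hC, hL, hG] at hmom
  simp only [Pi.zero_apply, add_zero] at hmom
  -- rewrite the time derivative as `λ³ R [c′ m + c′ Dm·y − W̃ m + Dm(W̃ y)·(−1)… ]`
  have hl3 : lam s ^ 3 ≠ 0 := pow_ne_zero 3 hl0.ne'
  have eRd : ∀ v, Rd v = Rc s (Rc' s (Rd v)) := fun v => (hRR' _).symm
  have eRd' : Rd' (x - a s) = -((lam s)⁻¹ • Rc' s (Rd y)) := by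
    rw [hxa, map_smul, hR]
    have := hRd'R y
    rw [← eq_neg_iff_add_eq_zero] at this
    rw [this, smul_neg]
  have key : lam s • (Rd (m y) + Rc s (fderiv ℝ m y (lam s • (Rd' (x - a s) - Rc' s adot) + l' • Rc' s (x - a s)))) +
      l' • Rc s (m y) = lam s ^ 3 • R (c' • m y + c' • fderiv ℝ m y y - W (m y) + fderiv ℝ m y (W y) +
        fderiv ℝ m y d) := by
    rw [eRd (m y), eRd', hxa]
    simp only [hWv, hd_def, hc'_def, ← hR, ← hR', map_smul, map_add, map_sub, map_neg, smul_add, smul_sub, smul_neg,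
      smul_smul, LinearIsometryEquiv.symm_apply_apply]
    have hl := hl0.ne'
    match_scalars <;> field_simp
  rw [key] at hmom
  -- extract the profile equation
  have hzero : lam s ^ 3 • R (c' • m y + c' • fderiv ℝ m y y - W (m y) + fderiv ℝ m y (W y) + fderiv ℝ m y d +
      convect m m y - ν • Δ m y + gradient π y) = 0 := by
    have e : lam s ^ 3 • R (c' • m y + c' • fderiv ℝ m y y - W (m y) + fderiv ℝ m y (W y) + fderiv ℝ m y d +
        convect m m y - ν • Δ m y + gradient π y) =
        lam s ^ 3 • R (c' • m y + c' • fderiv ℝ m y y - W (m y) + fderiv ℝ m y (W y) + fderiv ℝ m y d) +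
          lam s ^ 3 • R (convect m m y) - (ν • lam s ^ 3 • R (Δ m y) - lam s ^ 3 • R (gradient π y)) := by
      simp only [map_add, map_sub, LinearIsometryEquiv.map_smul, smul_add, smul_sub]
      module
    rw [e, hmom, sub_self]
  have hzero' : c' • m y + c' • fderiv ℝ m y y - W (m y) + fderiv ℝ m y (W y) + fderiv ℝ m y d +
      convect m m y - ν • Δ m y + gradient π y = 0 := by
    have h1 := (smul_eq_zero.1 hzero).resolve_left hl3
    exact R.injective (by rw [h1, map_zero])
  rw [← sub_eq_zero]
  calc ν • Δ m y - convect m m y - gradient π y -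
        (fderiv ℝ m y d + (fderiv ℝ m y (W y) - W (m y)) + c' • (m y + fderiv ℝ m y y))
      = -(c' • m y + c' • fderiv ℝ m y y - W (m y) + fderiv ℝ m y (W y) + fderiv ℝ m y d +
          convect m m y - ν • Δ m y + gradient π y) := by
        simp only [smul_add]; abel
    _ = 0 := by rw [hzero', neg_zero]

end ProfileLiouville

end MaximiserSetRigidity

end Summit.NavierStokesRegularity.NavierStokesRegularity.Theorems

end
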